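import Summits.Ventures.KdS.HorizonCert
import Summits.Ventures.KdS.MasslessScalar
import Literature.Geometry.Lorentzian.KerrDeSitterThresholdRays
import HarnessLib

/-!
# Venture KdS — rational bounds on `Δ_r'(r_j)`, `κ_j`, `Ω_SR`, `ϖ_j`, `conf0Sq` from a horizon certificate

HONEST FRAMING (venture `Summits/Ventures/KdS`, cell `pub-kds`): ELEMENTARY real analysis / bookkeeping, written so
that the "window constants" hypothesis (H4) of the box theorems can be discharged PER TILE by a finite list of
rational inequalities (`norm_num`). No claim about mode stability is made here.

From a valid `HorizonCert` on a `Tile`: two-sided rational bounds on `Δ_r'` at the three radii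
(`deltaDeriv_bounds_of_cert`: chord below / tangent above), and hence `κ₀ ≥ k0lo`, `κ₁ ≤ k1hi`, `κ₂ ≤ k2hi`,
`Ω_SR ≤ omhi` (via the Vieta form of the denominator, `superradiantDen_eq`), `ϖ₂ ≤ w2hi`, `ϖ₁ ≤ w1hi`,
`conf0Sq ≤ m²·w1hi² + 2Λhi/3` — all closed rational expressions in the certificate and tile data.
-/

noncomputable section

open Set

namespace Summit.Ventures.KdS

open Literature.Geometry.Lorentzian Literature.Geometry.Lorentzian.KerrDeSitter

section Cert

variable {c : HorizonCert} {t : Tile} (hv : c.Valid t) {a Λ : ℝ}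
  (ha : t.alo ≤ a ∧ a ≤ t.ahi) (hΛ : t.Λlo ≤ Λ ∧ Λ ≤ t.Λhi)
include hv ha hΛ

/-- The certificate's rational bounds on `Δ_r'` at the three radii: `Δ_r'(r₋) ≤ d0max < 0`,
`d1min ≤ Δ_r'(r₊) ≤ d1max`, `d2min ≤ Δ_r'(r_c) ≤ d2max < 0` (corner maxima/minima; see the
definitions). -/
def HorizonCert.d0max (c : HorizonCert) (t : Tile) : ℝ := t.cmax (dB1 c.r0hi)

/-- Lower bound for `Δ_r'(r₊)`. -/
def HorizonCert.d1min (c : HorizonCert) (t : Tile) : ℝ := min (t.cmin (dB1 c.r1lo)) (t.cmin (dB1 c.r1hi))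

/-- Upper bound for `Δ_r'(r₊)` (tangent at `r1lo`). -/
def HorizonCert.d1max (c : HorizonCert) (t : Tile) : ℝ :=
  t.cmax (dB1 c.r1lo) + max 0 (t.cmax (dB2 c.r1lo)) * (c.r1hi - c.r1lo)

/-- Lower bound for `Δ_r'(r_c)`. -/
def HorizonCert.d2min (c : HorizonCert) (t : Tile) : ℝ := t.cmin (dB1 c.r2hi)

/-- Upper bound for `Δ_r'(r_c)`. -/
def HorizonCert.d2max (c : HorizonCert) (t : Tile) : ℝ := t.cmax (dB1 c.r2lo)

/-- **Generic H4, part 2.** The derivative bounds at the three radii. -/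
theorem deltaDeriv_bounds_of_cert :
    deltaDeriv 1 a Λ (rMinus 1 a Λ) ≤ c.d0max t ∧ c.d0max t < 0 ∧
      c.d1min t ≤ deltaDeriv 1 a Λ (rPlus 1 a Λ) ∧ deltaDeriv 1 a Λ (rPlus 1 a Λ) ≤ c.d1max t ∧
      0 < c.d1min t ∧
      c.d2min t ≤ deltaDeriv 1 a Λ (rCosmo 1 a Λ) ∧ deltaDeriv 1 a Λ (rCosmo 1 a Λ) ≤ c.d2max t ∧
      c.d2max t < 0 := by
  obtain ⟨-, hr₀, hr₁, hr₂, -, -⟩ := horizons_of_cert hv ha hΛ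
  obtain ⟨-, -, -, -, -, -, d1, d2, d3, d4⟩ := signs_of_cert hv ha hΛ
  obtain ⟨-, -, e3⟩ := deltaDeriv_signs_of_cert hv ha hΛ
  have hB1 : ∀ r, deltaDeriv 1 a Λ r ≤ t.cmax (dB1 r) := fun r => by
    rw [deltaDeriv_eq_dB1]; exact le_cmax_bil hv ha hΛ _ _ _ _
  have hB1' : ∀ r, t.cmin (dB1 r) ≤ deltaDeriv 1 a Λ r := fun r => by
    rw [deltaDeriv_eq_dB1]; exact cmin_le_bil hv ha hΛ _ _ _ _
  have hB2 : ∀ r, deltaDeriv2 a Λ r ≤ t.cmax (dB2 r) := fun r => by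
    rw [deltaDeriv2_eq_dB2]; exact le_cmax_bil hv ha hΛ _ _ _ _
  have hvc := hv
  obtain ⟨⟨-, -, hL0, -⟩, ⟨h0, h00, h01, h11, h12, h22⟩, -, -, -, -, -, -, c1, c2, c3, c4⟩ := hvc
  have hΛ0 : 0 ≤ Λ := by linarith [hΛ.1]
  refine ⟨?_, ?_, ?_, ?_, ?_, ?_, ?_, ?_⟩
  · -- `Δ'(r₋) ≤ Δ'(r0hi) ≤ cmax`
    exact (deltaDeriv_le_before hΛ0 (by linarith [hr₀.1]) hr₀.2.le (by linarith) d1 d2).trans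
      (hB1 _)
  · simp only [HorizonCert.d0max, Tile.cmax, max4, max_lt_iff]; exact ⟨⟨c1.1, c1.2.1⟩, c1.2.2⟩
  · -- chord lower bound on `[r1lo, r1hi]`
    have := deltaDeriv_ge_min_between (M := 1) (a := a) hΛ0 (by linarith) hr₁.1.le hr₁.2.le
    exact le_trans (min_le_min (hB1' _) (hB1' _)) this
  · -- tangent upper bound at `r1lo`
    have ht := deltaDeriv_le_tangent (M := 1) (a := a) hΛ0 (show 0 ≤ c.r1lo by linarith)
      (show 0 ≤ rPlus 1 a Λ by linarith [hr₁.1])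
    have hw : 0 ≤ rPlus 1 a Λ - c.r1lo := by linarith [hr₁.1]
    have hw' : rPlus 1 a Λ - c.r1lo ≤ c.r1hi - c.r1lo := by linarith [hr₁.2]
    have h2 : deltaDeriv2 a Λ c.r1lo * (rPlus 1 a Λ - c.r1lo) ≤
        max 0 (t.cmax (dB2 c.r1lo)) * (c.r1hi - c.r1lo) := by
      calc deltaDeriv2 a Λ c.r1lo * (rPlus 1 a Λ - c.r1lo)
          ≤ max 0 (t.cmax (dB2 c.r1lo)) * (rPlus 1 a Λ - c.r1lo) :=
            mul_le_mul_of_nonneg_right ((hB2 _).trans (le_max_right _ _)) hw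
        _ ≤ max 0 (t.cmax (dB2 c.r1lo)) * (c.r1hi - c.r1lo) :=
            mul_le_mul_of_nonneg_left hw' (le_max_left _ _)
    unfold HorizonCert.d1max
    linarith [hB1 c.r1lo]
  · simp only [HorizonCert.d1min, Tile.cmin, min4, lt_min_iff]
    exact ⟨⟨⟨c2.1, c2.2.1⟩, c2.2.2⟩, ⟨c3.1, c3.2.1⟩, c3.2.2⟩
  · -- `Δ'(r2hi) ≤ Δ'(r_c)` (decreasing after `r_c`, which has `Δ'(r_c) < 0`)
    have hneg : deltaDeriv 1 a Λ (rCosmo 1 a Λ) < 0 := e3 _ hr₂.1.le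
    exact (hB1' _).trans
      (deltaDeriv_le_after hΛ0 (show 0 ≤ c.r1hi by linarith) (by linarith [hr₂.1]) hr₂.2.le d3 hneg)
  · exact (deltaDeriv_le_after hΛ0 (show 0 ≤ c.r1hi by linarith) h12 hr₂.1.le d3 d4).trans (hB1 _)
  · simp only [HorizonCert.d2max, Tile.cmax, max4, max_lt_iff]; exact ⟨⟨c4.1, c4.2.1⟩, c4.2.2⟩

end Cert

/-! ### Derived rational bounds -/

/-- Upper bound for `Ξ` on the tile. -/
def Tile.xiMax (t : Tile) : ℝ := 1 + t.Λhi / 3 * t.ahi ^ 2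

/-- Lower bound for `κ₀`. -/
def HorizonCert.k0lo (c : HorizonCert) (t : Tile) : ℝ :=
  -c.d0max t / (2 * t.xiMax * (c.r0hi ^ 2 + t.ahi ^ 2))

/-- Upper bound for `κ₁`. -/
def HorizonCert.k1hi (c : HorizonCert) (t : Tile) : ℝ := c.d1max t / (2 * (c.r1lo ^ 2 + t.alo ^ 2))

/-- Upper bound for `κ₂`. -/
def HorizonCert.k2hi (c : HorizonCert) (t : Tile) : ℝ := -c.d2min t / (2 * (c.r2lo ^ 2 + t.alo ^ 2))

/-- Lower bound for the denominator of `Ω_SR`, in the VIETA form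
`a² + 3/Λ − (r₋ + r_c)² = 2a² + r₊² + r₊(r₋ + r_c) − r₋ r_c` (`superradiantDen_eq`), which has no
cancellation at small `Λ` and is monotone in each radius on the brackets. -/
def HorizonCert.omDen (c : HorizonCert) (t : Tile) : ℝ :=
  2 * t.alo ^ 2 + c.r1lo ^ 2 + c.r1lo * (c.r0hi + c.r2lo) - c.r0hi * c.r2lo

/-- Upper bound for `Ω_SR`. -/
def HorizonCert.omhi (c : HorizonCert) (t : Tile) : ℝ := 2 * t.ahi / c.omDen t

/-- Upper bound for `ϖ₂`. -/
def HorizonCert.w2hi (c : HorizonCert) (t : Tile) : ℝ := t.ahi / (c.r2lo ^ 2 + t.alo ^ 2)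

/-- Upper bound for `ϖ₁`. -/
def HorizonCert.w1hi (c : HorizonCert) (t : Tile) : ℝ := t.ahi / (c.r1lo ^ 2 + t.alo ^ 2)

section Bounds

variable {c : HorizonCert} {t : Tile} (hv : c.Valid t) {a Λ : ℝ}
  (ha : t.alo ≤ a ∧ a ≤ t.ahi) (hΛ : t.Λlo ≤ Λ ∧ Λ ≤ t.Λhi)
include hv ha hΛ

/-- `1 ≤ Ξ ≤ xiMax` on the tile. -/
theorem xi_bounds_of_cert : 1 ≤ xi a Λ ∧ xi a Λ ≤ t.xiMax := by
  have hL0 : 0 < t.Λlo := hv.1.2.2.1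
  have ha0 : 0 < t.alo := hv.1.1
  unfold xi Tile.xiMax
  have h1 : 0 ≤ Λ / 3 * a ^ 2 := by have : 0 ≤ Λ := by linarith [hΛ.1]
                                    positivity
  have ha2 : a ^ 2 ≤ t.ahi ^ 2 := pow_le_pow_left₀ (by linarith [ha.1]) ha.2 2
  refine ⟨by linarith, ?_⟩
  have : Λ / 3 * a ^ 2 ≤ t.Λhi / 3 * t.ahi ^ 2 :=
    mul_le_mul (by linarith [hΛ.2]) ha2 (sq_nonneg a) (by linarith [hΛ.1, hΛ.2])
  linarith

/-- `κ₀ ≥ k0lo > 0`. -/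
theorem kappaCauchy_ge_of_cert :
    c.k0lo t ≤ surfaceGravity 1 a Λ (rMinus 1 a Λ) ∧ 0 < c.k0lo t := by
  obtain ⟨-, hr, -, -, -, -⟩ := horizons_of_cert hv ha hΛ
  obtain ⟨hd, hd0, -⟩ := deltaDeriv_bounds_of_cert hv ha hΛ
  obtain ⟨hx1, hx2⟩ := xi_bounds_of_cert hv ha hΛ
  have ha0 : 0 < t.alo := hv.1.1
  unfold surfaceGravity HorizonCert.k0lo
  rw [abs_of_neg (by linarith)]
  have ha2 : a ^ 2 ≤ t.ahi ^ 2 := pow_le_pow_left₀ (by linarith [ha.1]) ha.2 2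
  have hr2 : rMinus 1 a Λ ^ 2 ≤ c.r0hi ^ 2 := pow_le_pow_left₀ (by linarith [hr.1, hv.2.1.1]) hr.2.le 2
  have hapos : 0 < a := by linarith [ha.1]
  have hden : 0 < 2 * xi a Λ * (rMinus 1 a Λ ^ 2 + a ^ 2) := by positivity
  have hdenMax : 2 * xi a Λ * (rMinus 1 a Λ ^ 2 + a ^ 2) ≤ 2 * t.xiMax * (c.r0hi ^ 2 + t.ahi ^ 2) :=
    mul_le_mul (by linarith) (add_le_add hr2 ha2) (by positivity) (by linarith)
  have hDpos : 0 < 2 * t.xiMax * (c.r0hi ^ 2 + t.ahi ^ 2) := lt_of_lt_of_le hden hdenMax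
  refine ⟨?_, div_pos (by linarith) hDpos⟩
  calc -c.d0max t / (2 * t.xiMax * (c.r0hi ^ 2 + t.ahi ^ 2))
      ≤ -c.d0max t / (2 * xi a Λ * (rMinus 1 a Λ ^ 2 + a ^ 2)) :=
        div_le_div_of_nonneg_left (by linarith) hden hdenMax
    _ ≤ -deltaDeriv 1 a Λ (rMinus 1 a Λ) / (2 * xi a Λ * (rMinus 1 a Λ ^ 2 + a ^ 2)) :=
        div_le_div_of_nonneg_right (by linarith) hden.le

/-- `0 < κ₁ ≤ k1hi`. -/
theorem kappaEvent_le_of_cert :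
    0 < surfaceGravity 1 a Λ (rPlus 1 a Λ) ∧ surfaceGravity 1 a Λ (rPlus 1 a Λ) ≤ c.k1hi t := by
  obtain ⟨-, -, hr, -, -, -⟩ := horizons_of_cert hv ha hΛ
  obtain ⟨-, -, hd1, hd2, hdpos, -⟩ := deltaDeriv_bounds_of_cert hv ha hΛ
  obtain ⟨hx1, hx2⟩ := xi_bounds_of_cert hv ha hΛ
  have ha0 : 0 < t.alo := hv.1.1
  have h1lo : 0 < c.r1lo := by linarith [hv.2.1.1, hv.2.1.2.1, hv.2.1.2.2.1]
  unfold surfaceGravity HorizonCert.k1hi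
  have hpos : 0 < deltaDeriv 1 a Λ (rPlus 1 a Λ) := by linarith
  rw [abs_of_pos hpos]
  have ha2 : t.alo ^ 2 ≤ a ^ 2 := pow_le_pow_left₀ ha0.le ha.1 2
  have hr2 : c.r1lo ^ 2 ≤ rPlus 1 a Λ ^ 2 := pow_le_pow_left₀ h1lo.le hr.1.le 2
  have hDmin : 0 < 2 * (c.r1lo ^ 2 + t.alo ^ 2) := by positivity
  have hden : 2 * (c.r1lo ^ 2 + t.alo ^ 2) ≤ 2 * xi a Λ * (rPlus 1 a Λ ^ 2 + a ^ 2) := by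
    nlinarith [mul_le_mul hx1 (add_le_add hr2 ha2) (by positivity) (by linarith)]
  have hdenpos : 0 < 2 * xi a Λ * (rPlus 1 a Λ ^ 2 + a ^ 2) := lt_of_lt_of_le hDmin hden
  refine ⟨div_pos hpos hdenpos, ?_⟩
  calc deltaDeriv 1 a Λ (rPlus 1 a Λ) / (2 * xi a Λ * (rPlus 1 a Λ ^ 2 + a ^ 2))
      ≤ c.d1max t / (2 * xi a Λ * (rPlus 1 a Λ ^ 2 + a ^ 2)) :=
        div_le_div_of_nonneg_right hd2 hdenpos.le
    _ ≤ c.d1max t / (2 * (c.r1lo ^ 2 + t.alo ^ 2)) :=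
        div_le_div_of_nonneg_left (by linarith) hDmin hden

/-- `0 < κ₂ ≤ k2hi`. -/
theorem kappaCosmo_le_of_cert :
    0 < surfaceGravity 1 a Λ (rCosmo 1 a Λ) ∧ surfaceGravity 1 a Λ (rCosmo 1 a Λ) ≤ c.k2hi t := by
  obtain ⟨-, -, -, hr, -, -⟩ := horizons_of_cert hv ha hΛ
  obtain ⟨-, -, -, -, -, hd1, hd2, hdneg⟩ := deltaDeriv_bounds_of_cert hv ha hΛ
  obtain ⟨hx1, hx2⟩ := xi_bounds_of_cert hv ha hΛ
  have ha0 : 0 < t.alo := hv.1.1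
  have h2lo : 0 < c.r2lo := by
    linarith [hv.2.1.1, hv.2.1.2.1, hv.2.1.2.2.1, hv.2.1.2.2.2.1, hv.2.1.2.2.2.2.1]
  unfold surfaceGravity HorizonCert.k2hi
  have hneg : deltaDeriv 1 a Λ (rCosmo 1 a Λ) < 0 := by linarith
  rw [abs_of_neg hneg]
  have ha2 : t.alo ^ 2 ≤ a ^ 2 := pow_le_pow_left₀ ha0.le ha.1 2
  have hr2 : c.r2lo ^ 2 ≤ rCosmo 1 a Λ ^ 2 := pow_le_pow_left₀ h2lo.le hr.1.le 2
  have hDmin : 0 < 2 * (c.r2lo ^ 2 + t.alo ^ 2) := by positivity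
  have hden : 2 * (c.r2lo ^ 2 + t.alo ^ 2) ≤ 2 * xi a Λ * (rCosmo 1 a Λ ^ 2 + a ^ 2) := by
    nlinarith [mul_le_mul hx1 (add_le_add hr2 ha2) (by positivity) (by linarith)]
  have hdenpos : 0 < 2 * xi a Λ * (rCosmo 1 a Λ ^ 2 + a ^ 2) := lt_of_lt_of_le hDmin hden
  refine ⟨div_pos (by linarith) hdenpos, ?_⟩
  calc -deltaDeriv 1 a Λ (rCosmo 1 a Λ) / (2 * xi a Λ * (rCosmo 1 a Λ ^ 2 + a ^ 2))
      ≤ -c.d2min t / (2 * xi a Λ * (rCosmo 1 a Λ ^ 2 + a ^ 2)) :=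
        div_le_div_of_nonneg_right (by linarith) hdenpos.le
    _ ≤ -c.d2min t / (2 * (c.r2lo ^ 2 + t.alo ^ 2)) :=
        div_le_div_of_nonneg_left (by linarith) hDmin hden

/-- `0 ≤ Ω_SR ≤ omhi` (when the certified denominator bound is positive). -/
theorem superradiantUpper_le_of_cert (hden : 0 < c.omDen t) :
    0 ≤ superradiantUpper 1 a Λ ∧ superradiantUpper 1 a Λ ≤ c.omhi t := by
  obtain ⟨hsub, hr0, hr1, hr2, -, hz0⟩ := horizons_of_cert hv ha hΛ
  obtain ⟨-, hΛ0, h01, h12, hz1, hz2, -, -, -⟩ := hsub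
  have ha0 : 0 < t.alo := hv.1.1
  have hord := hv.2.1
  unfold superradiantUpper HorizonCert.omhi
  unfold HorizonCert.omDen at hden ⊢
  rw [superradiantDen_eq hΛ0.ne' h01.ne h12.ne (by linarith) hz0 hz1 hz2]
  -- monotone lower bound of the Vieta denominator on the brackets
  set r₀ := rMinus 1 a Λ
  set r₁ := rPlus 1 a Λ
  set r₂ := rCosmo 1 a Λ
  have ha2 : t.alo ^ 2 ≤ a ^ 2 := pow_le_pow_left₀ ha0.le ha.1 2
  have e1 : c.r0hi * (r₁ - r₂) ≤ r₀ * (r₁ - r₂) :=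
    mul_le_mul_of_nonpos_right hr0.2.le (by linarith)
  have e2 : c.r2lo * (r₁ - c.r0hi) ≤ r₂ * (r₁ - c.r0hi) :=
    mul_le_mul_of_nonneg_right hr2.1.le (by linarith [hr1.1, hord.2.2.1])
  have e3 : c.r1lo ^ 2 + c.r1lo * (c.r0hi + c.r2lo) ≤ r₁ ^ 2 + r₁ * (c.r0hi + c.r2lo) := by
    have h1lo : 0 ≤ c.r1lo := by linarith [hord.1, hord.2.1, hord.2.2.1]
    have : 0 ≤ c.r0hi + c.r2lo := by
      linarith [hord.1, hord.2.1, hord.2.2.1, hord.2.2.2.1, hord.2.2.2.2.1]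
    nlinarith [pow_le_pow_left₀ h1lo hr1.1.le 2, mul_le_mul_of_nonneg_right hr1.1.le this]
  have hD : 2 * t.alo ^ 2 + c.r1lo ^ 2 + c.r1lo * (c.r0hi + c.r2lo) - c.r0hi * c.r2lo ≤
      2 * a ^ 2 + r₁ ^ 2 + r₁ * (r₀ + r₂) - r₀ * r₂ := by nlinarith
  have hDpos : 0 < 2 * a ^ 2 + r₁ ^ 2 + r₁ * (r₀ + r₂) - r₀ * r₂ := lt_of_lt_of_le hden hD
  have h2a : 0 ≤ 2 * a := by linarith [ha.1]
  refine ⟨div_nonneg h2a hDpos.le, ?_⟩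
  calc 2 * a / (2 * a ^ 2 + r₁ ^ 2 + r₁ * (r₀ + r₂) - r₀ * r₂)
      ≤ 2 * t.ahi / (2 * a ^ 2 + r₁ ^ 2 + r₁ * (r₀ + r₂) - r₀ * r₂) :=
        div_le_div_of_nonneg_right (by linarith [ha.2]) hDpos.le
    _ ≤ 2 * t.ahi / (2 * t.alo ^ 2 + c.r1lo ^ 2 + c.r1lo * (c.r0hi + c.r2lo) - c.r0hi * c.r2lo) :=
        div_le_div_of_nonneg_left (by linarith [ha.1, ha.2]) hden hD

/-- `0 ≤ ϖ₂ ≤ w2hi`. -/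
theorem varpiCosmo_le_of_cert :
    0 ≤ horizonAngVel a (rCosmo 1 a Λ) ∧ horizonAngVel a (rCosmo 1 a Λ) ≤ c.w2hi t := by
  obtain ⟨-, -, -, hr, -, -⟩ := horizons_of_cert hv ha hΛ
  have ha0 : 0 < t.alo := hv.1.1
  have h2lo : 0 < c.r2lo := by
    linarith [hv.2.1.1, hv.2.1.2.1, hv.2.1.2.2.1, hv.2.1.2.2.2.1, hv.2.1.2.2.2.2.1]
  unfold horizonAngVel HorizonCert.w2hi
  have ha2 : t.alo ^ 2 ≤ a ^ 2 := pow_le_pow_left₀ ha0.le ha.1 2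
  have hr2 : c.r2lo ^ 2 ≤ rCosmo 1 a Λ ^ 2 := pow_le_pow_left₀ h2lo.le hr.1.le 2
  have hDmin : 0 < c.r2lo ^ 2 + t.alo ^ 2 := by positivity
  have hD : c.r2lo ^ 2 + t.alo ^ 2 ≤ rCosmo 1 a Λ ^ 2 + a ^ 2 := add_le_add hr2 ha2
  have hDpos : 0 < rCosmo 1 a Λ ^ 2 + a ^ 2 := lt_of_lt_of_le hDmin hD
  refine ⟨div_nonneg (by linarith [ha.1]) hDpos.le, ?_⟩
  calc a / (rCosmo 1 a Λ ^ 2 + a ^ 2) ≤ t.ahi / (rCosmo 1 a Λ ^ 2 + a ^ 2) :=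
        div_le_div_of_nonneg_right ha.2 hDpos.le
    _ ≤ t.ahi / (c.r2lo ^ 2 + t.alo ^ 2) := div_le_div_of_nonneg_left (by linarith [ha.1, ha.2]) hDmin hD

/-- `0 ≤ ϖ₁ ≤ w1hi`. -/
theorem varpiEvent_le_of_cert :
    0 ≤ horizonAngVel a (rPlus 1 a Λ) ∧ horizonAngVel a (rPlus 1 a Λ) ≤ c.w1hi t := by
  obtain ⟨-, -, hr, -, -, -⟩ := horizons_of_cert hv ha hΛ
  have ha0 : 0 < t.alo := hv.1.1
  have h1lo : 0 < c.r1lo := by linarith [hv.2.1.1, hv.2.1.2.1, hv.2.1.2.2.1]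
  unfold horizonAngVel HorizonCert.w1hi
  have ha2 : t.alo ^ 2 ≤ a ^ 2 := pow_le_pow_left₀ ha0.le ha.1 2
  have hr2 : c.r1lo ^ 2 ≤ rPlus 1 a Λ ^ 2 := pow_le_pow_left₀ h1lo.le hr.1.le 2
  have hDmin : 0 < c.r1lo ^ 2 + t.alo ^ 2 := by positivity
  have hD : c.r1lo ^ 2 + t.alo ^ 2 ≤ rPlus 1 a Λ ^ 2 + a ^ 2 := add_le_add hr2 ha2
  have hDpos : 0 < rPlus 1 a Λ ^ 2 + a ^ 2 := lt_of_lt_of_le hDmin hD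
  refine ⟨div_nonneg (by linarith [ha.1]) hDpos.le, ?_⟩
  calc a / (rPlus 1 a Λ ^ 2 + a ^ 2) ≤ t.ahi / (rPlus 1 a Λ ^ 2 + a ^ 2) :=
        div_le_div_of_nonneg_right ha.2 hDpos.le
    _ ≤ t.ahi / (c.r1lo ^ 2 + t.alo ^ 2) := div_le_div_of_nonneg_left (by linarith [ha.1, ha.2]) hDmin hD

/-- `conf0Sq 1 a Λ m ≤ m²·w1hi² + 2Λhi/3`. -/
theorem conf0Sq_le_of_cert (m : ℝ) : conf0Sq 1 a Λ m ≤ m ^ 2 * c.w1hi t ^ 2 + 2 * t.Λhi / 3 := by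
  obtain ⟨hw0, hw1⟩ := varpiEvent_le_of_cert hv ha hΛ
  obtain ⟨hx1, -⟩ := xi_bounds_of_cert hv ha hΛ
  unfold conf0Sq
  have h1 : horizonAngVel a (rPlus 1 a Λ) ^ 2 ≤ c.w1hi t ^ 2 := pow_le_pow_left₀ hw0 hw1 2
  have hΛ0 : 0 ≤ Λ := by linarith [hΛ.1, hv.1.2.2.1]
  have h2 : 2 * Λ / (3 * xi a Λ ^ 3) ≤ 2 * t.Λhi / 3 := by
    rw [div_le_div_iff₀ (by positivity) (by norm_num)]
    have : 1 ≤ xi a Λ ^ 3 := one_le_pow₀ hx1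
    nlinarith [hΛ.2]
  nlinarith [mul_le_mul_of_nonneg_left h1 (sq_nonneg m)]

end Bounds
end Summit.Ventures.KdS

end
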